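import Literature.NumberTheory.Weil1964.ArchFollandDualPairDefinitePlace
import HarnessLib

/-!
# The archimedean pair group at ONE real place: the section `U(σ_w J_V)(ℂ) × U(σ_w J_W)(ℂ) →* U(J_V)(E ⊗ ℝ) × U(J_W)(E ⊗ ℝ)` and its sign-frame components

Topic `NumberTheory/Weil1964`; namespace `Literature.NumberTheory.Weil1964`.  KERNEL MATHEMATICS ONLY: two explicit definitions
(group homomorphisms) and proved theorems; no `def … : Prop` record, no axiom, no proof hole.

weil-2's `archPairPlace v : U(J_V)(𝔸_F) × U(J_W)(𝔸_F) →* U(P_v,Q_v) × U(R_v,S_v)` (`ArchFollandDualPair` §5) reads the archimedean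
components of a pair element at the complex place `wOf v` over a real place `v`, in per-place sign frames.  The product phase
homomorphism of the (J-arch) datum (`HodgeCM/Model/HypCensus/ArchDatumPlaces`, `archPairPhaseHom`) is
`piPhaseHom … ∘ (v ↦ archPairPlace v (archToAdelic x, archToAdelic y))`, and `ArchPlacePhaseHomBlock.coe_reindexSp_piPhaseHom_comp_section`
turns a SECTION of `v ↦ archPairPlace v (archToAdelic ·, archToAdelic ·)` at one place `v₁` into the block-pair hypothesis of the
archimedean factorisation (`Model/ArchKTypeJunction` § 2).  This file supplies that section in local-group currency, from the period
lane's one-place section `UnitaryGroup.archSingle` (`Automorphic/UnitaryGroupArchSection`):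

* §1 **`archPairSingle w₁ : U(σ_{w₁} J_V)(ℂ) × U(σ_{w₁} J_W)(ℂ) →* U(J_V)(E ⊗ ℝ) × U(J_W)(E ⊗ ℝ)`**, `(x, y) ↦ (archSingle w₁ x,
  archSingle w₁ y)` at a complex place `w₁` (continuous, injective); §2 at a real place `v₁` (`w₁ = wOf v₁`) the frame map **`archPairFrame v₁ : U(σ_{w(v₁)} J_V)(ℂ) × U(σ_{w(v₁)} J_W)(ℂ) →*
  U(P_{v₁},Q_{v₁}) × U(R_{v₁},S_{v₁})`** (= `archPairPlace v₁ ∘ adelicSingle (wOf v₁)` on each factor, i.e. the Sylvester frames `toUForm`,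
  `archPairFrame_apply_eq_toUForm`; continuous, bijective);
* §2 the components: at the place itself `archPairPlace v₁ (archPairSingle v₁ u)^∼ = archPairFrame v₁ u`
  (`archPairPlace_archPairSingle_self`), away from it `archPairPlace v (archPairSingle v₁ u)^∼ = 1` (`archPairPlace_archPairSingle_of_ne`,
  `wOf` is injective by `hover`), packaged as **`archPairPlace_archPairSingle :
  (v ↦ archPairPlace v (archToAdelic (archPairSingle v₁ u).1, archToAdelic (archPairSingle v₁ u).2)) = Pi.mulSingle v₁ (archPairFrame v₁ u)`**
  — the `hsec` input of `coe_reindexSp_piPhaseHom_comp_section` for the section `archPairSingle v₁ ∘ (archPairFrame v₁)⁻¹`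
  (the inverse as a topological isomorphism is `toUFormEquiv` of `ArchFollandDualPairDefinitePlaceSlice`, factor by factor).

Everything is PROVED; nothing cited is a hypothesis.

## References

* [BorelJacquet1979] A. Borel, H. Jacquet, *Automorphic forms and automorphic representations*, Proc. Symp. Pure Math. 33.1 (1979),
  §4.1 (`G_∞ = ∏_{v ∣ ∞} G(F_v)`, factor inclusions).
* [MoeglinVignerasWaldspurger1987] C. Mœglin, M.-F. Vignéras, J.-L. Waldspurger, LNM 1291 (1987), Ch. 1 I.17 (the pair `(U(V), U(W))`).
* [KonnoKonno2007] K. Konno, T. Konno, Kyushu J. Math. 61 (2007), §3.1 (3.1) (sign frames of `U(p,q) × U(r,s)`).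

## Provenance

LEAN-IN-TREE rule (2026-08-18), pub-hodgecm model-construction sub-cell, discharge seat mc-discharge-3 (ticket D-3 row (T4), desk
(XXXXX′)(2): the pair section at one real place).  Nothing here is a claim of the manuscripts adjudicated by that cell.
-/

set_option autoImplicit false

noncomputable section

open NumberField NumberField.InfinitePlace

namespace Literature.NumberTheory.Weil1964

open Literature.NumberTheory.Automorphic Literature.NumberTheory.Automorphic.UnitaryGroup
open Literature.RepresentationTheory.KonnoKonno2007 Literature.RepresentationTheory.KonnoKonno2007.RealDualPair

section Single

variable (F E : Type) [Field F] [Field E] [Algebra F E] (c : E ≃ₐ[F] E) (N M : ℕ)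
  (JV : Matrix (Fin N) (Fin N) E) (JW : Matrix (Fin M) (Fin M) E) (hc : c ≠ 1) (hfix : ∀ w : InfinitePlace E, c • w = w)
  (w₁ : {w : InfinitePlace E // w.IsComplex})

/-! ## §1 The pair section at one complex place -/

/-- **The pair section at the complex place `w₁`** (local-group currency): `(x, y) ↦ (archSingle w₁ x, archSingle w₁ y)`, the
element of `U(J_V)(E ⊗ ℝ) × U(J_W)(E ⊗ ℝ)` with components `x`, `y` at `w₁` and `1` at every other complex place.
[cite: BorelJacquet1979, §4.1; MoeglinVignerasWaldspurger1987, Ch. 1 I.17] -/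
def archPairSingle :
    archLocal E N JV w₁ × archLocal E M JW w₁ →* UnitaryGroup.arch F E c N JV × UnitaryGroup.arch F E c M JW :=
  (archSingle F E c N JV hc hfix w₁).prodMap (archSingle F E c M JW hc hfix w₁)

/-- components of `archPairSingle`. [folklore] -/
@[simp] theorem archPairSingle_apply (u : archLocal E N JV w₁ × archLocal E M JW w₁) :
    archPairSingle F E c N M JV JW hc hfix w₁ u = (archSingle F E c N JV hc hfix w₁ u.1, archSingle F E c M JW hc hfix w₁ u.2) :=
  rfl

/-- `archPairSingle w₁` is continuous. [folklore] -/
theorem continuous_archPairSingle : Continuous (archPairSingle F E c N M JV JW hc hfix w₁) :=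
  (continuous_archSingle F E c N JV hc hfix w₁).prodMap (continuous_archSingle F E c M JW hc hfix w₁)

/-- `archPairSingle w₁` is injective. [folklore] -/
theorem archPairSingle_injective : Function.Injective (archPairSingle F E c N M JV JW hc hfix w₁) :=
  fun _ _ h => Prod.ext (archSingle_injective F E c N JV hc hfix w₁ (congrArg Prod.fst h))
    (archSingle_injective F E c M JW hc hfix w₁ (congrArg Prod.snd h))

end Single

section PlaceSection

variable {F : Type} [Field F] [NumberField F] (E : Type) [Field E] [NumberField E] [Algebra F E] (c : E ≃ₐ[F] E)
  (N M : ℕ) (hc : c ≠ 1)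
  (wOf : {v : InfinitePlace F // v.IsReal} → {w : InfinitePlace E // w.IsComplex})
  (hw : ∀ v, c • (wOf v).1 = (wOf v).1) (hover : ∀ v, (wOf v).1.comap (algebraMap F E) = v.1)
  (tV : Fin N → F) (tW : Fin M → F) {JV : Matrix (Fin N) (Fin N) E} {JW : Matrix (Fin M) (Fin M) E}
  (hJV : JV = (Matrix.diagonal tV).map (algebraMap F E)) (hJW : JW = (Matrix.diagonal tW).map (algebraMap F E))
  {P Q R S : {v : InfinitePlace F // v.IsReal} → Type*} [∀ v, Fintype (P v)] [∀ v, DecidableEq (P v)]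
  [∀ v, Fintype (Q v)] [∀ v, DecidableEq (Q v)] [∀ v, Fintype (R v)] [∀ v, DecidableEq (R v)]
  [∀ v, Fintype (S v)] [∀ v, DecidableEq (S v)]
  (εV : ∀ v, Fin N ≃ P v ⊕ Q v) (εW : ∀ v, Fin M ≃ R v ⊕ S v)
  {DV : {v : InfinitePlace F // v.IsReal} → Fin N → ℝ} {DW : {v : InfinitePlace F // v.IsReal} → Fin M → ℝ}
  (hDV0 : ∀ v i, DV v i ≠ 0) (hDW0 : ∀ v j, DW v j ≠ 0) {cV cW : {v : InfinitePlace F // v.IsReal} → ℝ}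
  (hcV : ∀ v, cV v ≠ 0) (hcW : ∀ v, cW v ≠ 0)
  (htV : ∀ v i, embedding_of_isReal v.2 (tV i) = cV v * signOf (εV v i) * DV v i ^ 2)
  (htW : ∀ v j, embedding_of_isReal v.2 (tW j) = cW v * signOf (εW v j) * DW v j ^ 2)
  (hfix : ∀ w : InfinitePlace E, c • w = w) (v₁ : {v : InfinitePlace F // v.IsReal})

/-! ## §2 The pair frame at one real place and the place components of the section -/

/-- **The pair frame at the real place `v₁`**: `(x, y) ↦ archPairPlace v₁ (adelicSingle (wOf v₁) x, adelicSingle (wOf v₁) y)`, i.e.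
the two local unitary groups at `wOf v₁` placed in their sign frames `U(P_{v₁},Q_{v₁}) × U(R_{v₁},S_{v₁})` (= the Sylvester frames
`toUForm`, `archPairFrame_apply_eq_toUForm`). [cite: KonnoKonno2007, §3.1 (3.1); MoeglinVignerasWaldspurger1987, Ch. 1 I.17] -/
def archPairFrame :
    archLocal E N JV (wOf v₁) × archLocal E M JW (wOf v₁) →* Ginf (P v₁) (Q v₁) (R v₁) (S v₁) :=
  (archPairPlace E c N M hc wOf hw hover tV tW hJV hJW εV εW hDV0 hDW0 hcV hcW htV htW v₁).comp
    ((adelicSingle F E c N JV hc hfix (wOf v₁)).prodMap (adelicSingle F E c M JW hc hfix (wOf v₁)))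

/-- unfolding `archPairFrame`. [folklore] -/
theorem archPairFrame_apply (u : archLocal E N JV (wOf v₁) × archLocal E M JW (wOf v₁)) :
    archPairFrame E c N M hc wOf hw hover tV tW hJV hJW εV εW hDV0 hDW0 hcV hcW htV htW hfix v₁ u =
      archPairPlace E c N M hc wOf hw hover tV tW hJV hJW εV εW hDV0 hDW0 hcV hcW htV htW v₁
        (adelicSingle F E c N JV hc hfix (wOf v₁) u.1, adelicSingle F E c M JW hc hfix (wOf v₁) u.2) := rfl

/-- **the pair frame IS the pair of Sylvester frames** `toUForm` at `wOf v₁` (`archUForm_adelicSingle`, factor by factor).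
[cite: KonnoKonno2007, §3.1 (3.1)] -/
theorem archPairFrame_apply_eq_toUForm (u : archLocal E N JV (wOf v₁) × archLocal E M JW (wOf v₁)) :
    archPairFrame E c N M hc wOf hw hover tV tW hJV hJW εV εW hDV0 hDW0 hcV hcW htV htW hfix v₁ u =
      (toUForm (εV v₁) (hDV0 v₁) (hcV v₁) ((formCongr_scaleGL_smul_signForm (εV v₁) (hDV0 v₁) (cV v₁) (htV v₁)).trans
          (archLocalForm_diagonal E c N hc wOf hw hover tV hJV v₁).symm) u.1,
        toUForm (εW v₁) (hDW0 v₁) (hcW v₁) ((formCongr_scaleGL_smul_signForm (εW v₁) (hDW0 v₁) (cW v₁) (htW v₁)).trans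
          (archLocalForm_diagonal E c M hc wOf hw hover tW hJW v₁).symm) u.2) := by
  rw [archPairFrame_apply]
  exact Prod.ext
    ((archPairPlace_fst E c N M hc wOf hw hover tV tW hJV hJW εV εW hDV0 hDW0 hcV hcW htV htW v₁ _).trans
      (archUForm_adelicSingle E c N hc wOf hw hover tV hJV v₁ (εV v₁) (hDV0 v₁) (hcV v₁) (htV v₁) hfix u.1))
    ((archPairPlace_snd E c N M hc wOf hw hover tV tW hJV hJW εV εW hDV0 hDW0 hcV hcW htV htW v₁ _).trans
      (archUForm_adelicSingle E c M hc wOf hw hover tW hJW v₁ (εW v₁) (hDW0 v₁) (hcW v₁) (htW v₁) hfix u.2))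

/-- `archPairFrame v₁` is continuous. [folklore] -/
theorem continuous_archPairFrame :
    Continuous (archPairFrame E c N M hc wOf hw hover tV tW hJV hJW εV εW hDV0 hDW0 hcV hcW htV htW hfix v₁) :=
  (continuous_archPairPlace E c N M hc wOf hw hover tV tW hJV hJW εV εW hDV0 hDW0 hcV hcW htV htW v₁).comp
    ((continuous_adelicSingle F E c N JV hc hfix (wOf v₁)).prodMap (continuous_adelicSingle F E c M JW hc hfix (wOf v₁)))

/-- `archPairFrame v₁` is a bijection (each factor is the Sylvester frame `toUForm`, a bijection). [folklore] -/
theorem archPairFrame_bijective :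
    Function.Bijective (archPairFrame E c N M hc wOf hw hover tV tW hJV hJW εV εW hDV0 hDW0 hcV hcW htV htW hfix v₁) := by
  have h : (archPairFrame E c N M hc wOf hw hover tV tW hJV hJW εV εW hDV0 hDW0 hcV hcW htV htW hfix v₁ :
      archLocal E N JV (wOf v₁) × archLocal E M JW (wOf v₁) → Ginf (P v₁) (Q v₁) (R v₁) (S v₁)) =
      Prod.map
        (toUForm (εV v₁) (hDV0 v₁) (hcV v₁) ((formCongr_scaleGL_smul_signForm (εV v₁) (hDV0 v₁) (cV v₁) (htV v₁)).trans
          (archLocalForm_diagonal E c N hc wOf hw hover tV hJV v₁).symm))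
        (toUForm (εW v₁) (hDW0 v₁) (hcW v₁) ((formCongr_scaleGL_smul_signForm (εW v₁) (hDW0 v₁) (cW v₁) (htW v₁)).trans
          (archLocalForm_diagonal E c M hc wOf hw hover tW hJW v₁).symm)) :=
    funext fun u => archPairFrame_apply_eq_toUForm E c N M hc wOf hw hover tV tW hJV hJW εV εW hDV0 hDW0 hcV hcW htV htW
      hfix v₁ u
  rw [h]
  exact (toUForm_bijective _ _ _ _).prodMap (toUForm_bijective _ _ _ _)

omit [NumberField F] [NumberField E] in
/-- `wOf` is injective: the complex place over `v` determines `v` (`hover`). [folklore] -/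
theorem injective_wOf_of_comap (hover : ∀ v, (wOf v).1.comap (algebraMap F E) = v.1) : Function.Injective wOf :=
  fun v v' h => Subtype.ext (by rw [← hover v, ← hover v', h])

/-- **At the place itself**: the components at `v₁` of the section are the framed local elements.
[cite: BorelJacquet1979, §4.1] -/
theorem archPairPlace_archPairSingle_self (u : archLocal E N JV (wOf v₁) × archLocal E M JW (wOf v₁)) :
    archPairPlace E c N M hc wOf hw hover tV tW hJV hJW εV εW hDV0 hDW0 hcV hcW htV htW v₁
        (UnitaryGroup.archToAdelic F E c N JV (archPairSingle F E c N M JV JW hc hfix (wOf v₁) u).1,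
          UnitaryGroup.archToAdelic F E c M JW (archPairSingle F E c N M JV JW hc hfix (wOf v₁) u).2) =
      archPairFrame E c N M hc wOf hw hover tV tW hJV hJW εV εW hDV0 hDW0 hcV hcW htV htW hfix v₁ u := rfl

/-- **Away from the place**: the components at `v ≠ v₁` of the section are trivial. [cite: BorelJacquet1979, §4.1] -/
theorem archPairPlace_archPairSingle_of_ne {v : {v : InfinitePlace F // v.IsReal}} (hv : v ≠ v₁)
    (u : archLocal E N JV (wOf v₁) × archLocal E M JW (wOf v₁)) :
    archPairPlace E c N M hc wOf hw hover tV tW hJV hJW εV εW hDV0 hDW0 hcV hcW htV htW v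
        (UnitaryGroup.archToAdelic F E c N JV (archPairSingle F E c N M JV JW hc hfix (wOf v₁) u).1,
          UnitaryGroup.archToAdelic F E c M JW (archPairSingle F E c N M JV JW hc hfix (wOf v₁) u).2) = 1 := by
  have hw' : wOf v ≠ wOf v₁ := fun h => hv (injective_wOf_of_comap E wOf hover h)
  refine Prod.ext ?_ ?_
  · rw [archPairPlace_fst, archPairSingle_apply, Prod.fst_one]
    show toUForm (εV v) (hDV0 v) (hcV v) _ (archAt F E c N JV (wOf v) (hw v) hc
      (archPart F E c N JV (UnitaryGroup.archToAdelic F E c N JV (archSingle F E c N JV hc hfix (wOf v₁) u.1)))) = 1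
    rw [archPart_archToAdelic, archAt_archSingle_of_ne F E c N JV hc hfix (wOf v₁) hw']
    exact map_one _
  · rw [archPairPlace_snd, archPairSingle_apply, Prod.snd_one]
    show toUForm (εW v) (hDW0 v) (hcW v) _ (archAt F E c M JW (wOf v) (hw v) hc
      (archPart F E c M JW (UnitaryGroup.archToAdelic F E c M JW (archSingle F E c M JW hc hfix (wOf v₁) u.2)))) = 1
    rw [archPart_archToAdelic, archAt_archSingle_of_ne F E c M JW hc hfix (wOf v₁) hw']
    exact map_one _

/-- **The section property**, all places at once: the place components of `archPairSingle (wOf v₁) u` are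
`archPairFrame v₁ u` at `v₁` and `1` elsewhere — the `hsec` input of `ArchPlacePhaseHomBlock.coe_reindexSp_piPhaseHom_comp_section`
(with `ϖ` the place map of `archPairPhaseHom` and the section `archPairSingle (wOf v₁) ∘ (archPairFrame v₁)⁻¹`).
[cite: BorelJacquet1979, §4.1; KonnoKonno2007, §3.1 (3.1)] -/
theorem archPairPlace_archPairSingle [DecidableEq {v : InfinitePlace F // v.IsReal}]
    (u : archLocal E N JV (wOf v₁) × archLocal E M JW (wOf v₁)) :
    (fun v => archPairPlace E c N M hc wOf hw hover tV tW hJV hJW εV εW hDV0 hDW0 hcV hcW htV htW v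
        (UnitaryGroup.archToAdelic F E c N JV (archPairSingle F E c N M JV JW hc hfix (wOf v₁) u).1,
          UnitaryGroup.archToAdelic F E c M JW (archPairSingle F E c N M JV JW hc hfix (wOf v₁) u).2)) =
      Pi.mulSingle (M := fun v => Ginf (P v) (Q v) (R v) (S v)) v₁
        (archPairFrame E c N M hc wOf hw hover tV tW hJV hJW εV εW hDV0 hDW0 hcV hcW htV htW hfix v₁ u) := by
  funext v
  by_cases hv : v = v₁
  · subst hv
    rw [Pi.mulSingle_eq_same]
    exact archPairPlace_archPairSingle_self E c N M hc wOf hw hover tV tW hJV hJW εV εW hDV0 hDW0 hcV hcW htV htW hfix v u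
  · rw [Pi.mulSingle_eq_of_ne hv]
    exact archPairPlace_archPairSingle_of_ne E c N M hc wOf hw hover tV tW hJV hJW εV εW hDV0 hDW0 hcV hcW htV htW hfix v₁
      hv u

/-- the same for a PREIMAGE under the frame: if `archPairFrame v₁ u = g` then the place components of `archPairSingle (wOf v₁) u`
are `Pi.mulSingle v₁ g` — the form used with any inverse of the (bijective) frame. [folklore] -/
theorem archPairPlace_archPairSingle_of_frame_eq [DecidableEq {v : InfinitePlace F // v.IsReal}]
    (u : archLocal E N JV (wOf v₁) × archLocal E M JW (wOf v₁)) {g : Ginf (P v₁) (Q v₁) (R v₁) (S v₁)}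
    (hg : archPairFrame E c N M hc wOf hw hover tV tW hJV hJW εV εW hDV0 hDW0 hcV hcW htV htW hfix v₁ u = g) :
    (fun v => archPairPlace E c N M hc wOf hw hover tV tW hJV hJW εV εW hDV0 hDW0 hcV hcW htV htW v
        (UnitaryGroup.archToAdelic F E c N JV (archPairSingle F E c N M JV JW hc hfix (wOf v₁) u).1,
          UnitaryGroup.archToAdelic F E c M JW (archPairSingle F E c N M JV JW hc hfix (wOf v₁) u).2)) =
      Pi.mulSingle (M := fun v => Ginf (P v) (Q v) (R v) (S v)) v₁ g := by
  rw [← hg]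
  exact archPairPlace_archPairSingle E c N M hc wOf hw hover tV tW hJV hJW εV εW hDV0 hDW0 hcV hcW htV htW hfix v₁ u

end PlaceSection

end Literature.NumberTheory.Weil1964
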